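import Mathlib.GroupTheory.Perm.Fin
import Summits.CriticalPhenomena.PercolationContinuityZ3.Theorems.PercNearOneGluingNoHeavyLowerTailSahiGridPatternCaterpillarDefs
import Summits.CriticalPhenomena.PercolationContinuityZ3.Theorems.PercNearOneGluingNoHeavyLowerTailSahiGridPatternLiteralSteps
import Summits.CriticalPhenomena.PercolationContinuityZ3.Theorems.PercNearOneGluingNoHeavyLowerTailSahiGridPatternStarLiteralGeneral

/-!
# `NoHeavyLowerTail` (crux stmt-CriticalPhenomena-4575), Sahi programme P1: **THE CATERPILLAR READ-ONCE THEOREM** —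
# Kahn's `E₃(1_A, 1_B, 1_C) ≥ 0` whenever `A` is cut out by a caterpillar read-once monotone formula

Support file (Sahi cell, seat `prim-sahi-p1`, generation 26; `--supports stmt-CriticalPhenomena-4575`).  Pure proofs, no definitions,
no `sorry`, standard axioms.  Vocabulary: `…SahiGridPattern` (`sStarD`, `Ssym`, `pb`, `PatternPos`), `…CellForm` (`glue`, `cellOf`),
`…CaterpillarDefs` (`catEval`, `litVal`), the four one-axis literal steps of `…LiteralSteps` (generation 25: `literalUnion`/T1/T2/T2'),
and the transfer `sStarD_nonneg_transfer` of `…TwoOrthantGeneral`.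

THE MATHEMATICS.  Call an up-set `U ⊆ [3]^K` GOOD IN EVERY POSITION if for every `d`, every injection `σ : Fin K ↪ Fin d` and all
up-sets `B, C ⊆ [3]^d` the set `{y ∈ [3]^d : (y ∘ σ) ∈ U}` (the pattern `U` placed on the axes `σ`, all other axes free) satisfies
`sStarD ≥ 0`.  The four literal steps of generation 25 send "good (own dimension, all up-set pairs)" to "good" for the glued sets
`{(ξ,z) : [t ≤ ξ] ⋄ z ∈ U}` (`⋄ ∈ {∨,∧}`, `t ∈ {1,2}`); conjugating by the axis permutation `0 ↦ p, 1+i ↦ p.succAbove i`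
(`Fin.cycleRange`) shows that GOODNESS IN EVERY POSITION is preserved when one literal on a fresh axis is attached by `∨` or `∧` —
degenerate literals (always / never true) give the whole cube, the empty set, or the inner pattern with one more free axis.
Induction along the formula from the seeds `⊤`, `∅`:
* **`sStarD_caterpillar_nonneg`** (pattern level, every `d`): for every caterpillar formula (`K`, `ops`, thresholds
  `thr : Fin K → Option (Fin 3)`, seed `w`) and every injection `σ : Fin K → Fin d`, the up-set
  `{y ∈ [3]^d : catEval K ops (i ↦ litVal (thr i) (y (σ i))) w}` is a good first slot: `0 ≤ sStarD A B C` for all up-sets `B, C`.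
* VALUE LEVEL (`Ssym_nonneg_caterpillar`, `latticeE3_gridProd_nonneg_caterpillar`, **`sahiE_three_caterpillar_nonneg`**): for every
  product probability weight on every grid `[K'+1]^d`, every caterpillar read-once monotone formula `F` in threshold literals
  `[c_i ≤ x_{σ i}]` on DISTINCT coordinates `σ i`, and all increasing `B, C`:
      `0 ≤ E₃(1_A, 1_B, 1_C)`,  `A = {x : F(x)}`
  — Kahn's Conjecture 5 / Sahi's `C₃` when one of the three increasing events is a caterpillar read-once function
  (e.g. `x₁ ∧ (x₂ ∨ (x₃ ∧ (x₄ ∨ x₅)))`, `(x₁ ∨ x₂ ∨ x₃) ∧ x₄ ∧ x₅ ∨ x₆`; binary cube `K' = 1`).  Previously in the tree: clause ∨ one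
  monomial (`sahiE_three_clauseOrthant_nonneg`, the caterpillars with all `∧` below all `∨`), clause ∨ two monomials.
  NOT covered: two wide blocks joined at the root, e.g. `x₁x₂ ∨ x₃x₄ ∨ x₅x₆` (generation 25's Conjecture Λ).
Nothing here asserts `PatternPos d` for `d ≥ 4`. [this work]
-/

namespace Summit.CriticalPhenomena.PercolationContinuityZ3.Theorems.SahiGridPattern

open Finset SahiGrid3 Literature.Probability.LatticeModels Literature.Combinatorics.Sahi2008
open scoped BigOperators

/-! ### Pattern level: caterpillar patterns are good first slots, in every position and every dimension -/

/-- **THE CATERPILLAR PATTERN THEOREM** (every `d`): for a caterpillar read-once formula with threshold literals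
`litVal (thr i)` placed on distinct axes `σ i` of `[3]^d` (all other axes free), the set `A` it cuts out satisfies
`0 ≤ sStarD A B C` for all up-sets `B, C ⊆ [3]^d`. [this work] -/
theorem sStarD_caterpillar_nonneg : ∀ (K : ℕ) (ops : Fin K → Bool) (thr : Fin K → Option (Fin 3)) (w : Bool)
    (d : ℕ) (σ : Fin K → Fin d), Function.Injective σ →
    ∀ A : Finset (Pd d), (∀ y : Pd d, y ∈ A ↔ catEval K ops (fun i => litVal (thr i) (y (σ i))) w = true) →
    ∀ B C : Finset (Pd d), IsUpperSet (B : Set (Pd d)) → IsUpperSet (C : Set (Pd d)) → 0 ≤ sStarD A B C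
  | 0 => by
      intro ops thr w d σ _ A hA B C hB hC
      cases w
      · have e : A = ∅ := Finset.eq_empty_of_forall_notMem fun y hy => by simpa using (hA y).1 hy
        rw [e, sStarD_empty_left]
      · have e : A = univ := Finset.eq_univ_of_forall fun y => (hA y).2 (by simp)
        rw [e]; exact sStarD_nonneg_of_eq_univ₁ hB hC
  | K + 1 => by
      intro ops thr w d σ hσ A hA B C hB hC
      cases d with
      | zero => exact Fin.elim0 (σ 0)
      | succ d' =>
      classical
      -- the inner formula (literals `1, …, K`) and its value at a point of the big cube
      set ops' : Fin K → Bool := fun j => ops j.succ with hops'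
      set thr' : Fin K → Option (Fin 3) := fun j => thr j.succ with hthr'
      set p : Fin (d' + 1) := σ 0 with hp
      have hσ' : Function.Injective (fun j : Fin K => σ j.succ) := fun j j' h => Fin.succ_injective _ (hσ h)
      have hmemA : ∀ x : Pd (d' + 1), x ∈ A ↔ (if ops 0 = true then
          litVal (thr 0) (x p) || catEval K ops' (fun j => litVal (thr' j) (x (σ j.succ))) w
          else litVal (thr 0) (x p) && catEval K ops' (fun j => litVal (thr' j) (x (σ j.succ))) w) = true := fun x => by
        rw [hA x, catEval_succ]
      -- (F2) the inner pattern placed on the axes `σ ∘ succ` (axis `p` free) is good, by induction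
      have hinner : ∀ A₁ : Finset (Pd (d' + 1)),
          (∀ x : Pd (d' + 1), x ∈ A₁ ↔ catEval K ops' (fun j => litVal (thr' j) (x (σ j.succ))) w = true) →
          0 ≤ sStarD A₁ B C := fun A₁ hA₁ =>
        sStarD_caterpillar_nonneg K ops' thr' w (d' + 1) (fun j => σ j.succ) hσ' A₁ hA₁ B C hB hC
      -- (F3) the inner pattern on `[3]^{d'}` (axis `p` removed), good by induction, and the axis equivalence
      have hg : ∀ j : Fin K, ∃ i : Fin d', p.succAbove i = σ j.succ := fun j =>
        Fin.exists_succAbove_eq (fun h => Fin.succ_ne_zero j (hσ (h.trans hp)))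
      choose g hg using hg
      have hginj : Function.Injective g := fun j j' h => by
        have e := congrArg p.succAbove h
        rw [hg, hg] at e
        exact Fin.succ_injective _ (hσ e)
      set U' : Finset (Pd d') := univ.filter fun z : Pd d' => catEval K ops' (fun j => litVal (thr' j) (z (g j))) w = true
        with hU'
      have hU'mem : ∀ z : Pd d', z ∈ U' ↔ catEval K ops' (fun j => litVal (thr' j) (z (g j))) w = true := fun z => by
        rw [hU', Finset.mem_filter]; simp
      have hgood : ∀ P R : Finset (Pd d'), IsUpperSet (P : Set (Pd d')) → IsUpperSet (R : Set (Pd d')) → 0 ≤ sStarD U' P R :=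
        sStarD_caterpillar_nonneg K ops' thr' w d' g hginj U' hU'mem
      have hU'up : IsUpperSet (U' : Set (Pd d')) := by
        intro z z' hle hz
        rw [Finset.mem_coe, hU'mem] at hz ⊢
        exact catEval_mono K ops' (fun j hj => litVal_mono (hle (g j)) hj) w hz
      let ε : Fin (1 + d') ≃ Fin (d' + 1) := (finCongr (Nat.add_comm 1 d')).trans p.cycleRange.symm
      have hε0 : ε (Fin.castAdd d' (0 : Fin 1)) = p := by
        show p.cycleRange.symm (finCongr _ (Fin.castAdd d' 0)) = p
        have e : finCongr (Nat.add_comm 1 d') (Fin.castAdd d' (0 : Fin 1)) = 0 := Fin.ext (by simp)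
        rw [e, Fin.cycleRange_symm_zero]
      have hε1 : ∀ i : Fin d', ε (Fin.natAdd 1 i) = p.succAbove i := fun i => by
        show p.cycleRange.symm (finCongr _ (Fin.natAdd 1 i)) = _
        have e : finCongr (Nat.add_comm 1 d') (Fin.natAdd 1 i) = i.succ := Fin.ext (by simp)
        rw [e, Fin.cycleRange_symm_succ]
      have hhead : ∀ x : Pd (d' + 1), (x ∘ ε) (Fin.castAdd d' (0 : Fin 1)) = x p := fun x => by
        rw [Function.comp_apply, hε0]
      have hcell : ∀ x : Pd (d' + 1), cellOf (n := 1) (x ∘ ε) ∈ U' ↔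
          catEval K ops' (fun j => litVal (thr' j) (x (σ j.succ))) w = true := fun x => by
        rw [hU'mem]
        have e : (fun j => litVal (thr' j) (cellOf (n := 1) (x ∘ ε) (g j))) = fun j => litVal (thr' j) (x (σ j.succ)) := by
          funext j
          simp only [cellOf, Function.comp_apply, hε1, hg]
        rw [e]
      -- case analysis on the outermost literal
      rcases hthr0 : thr 0 with _ | t
      · -- never-true literal
        by_cases h0 : ops 0 = true
        · -- `never ∨ inner` = inner (axis `p` free)
          refine hinner A fun x => ?_
          rw [hmemA x, if_pos h0, hthr0, litVal_none, Bool.false_or]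
        · -- `never ∧ inner` = ∅
          have e : A = ∅ := Finset.eq_empty_of_forall_notMem fun x hx => by
            have h := (hmemA x).1 hx
            rw [if_neg h0, hthr0, litVal_none, Bool.false_and] at h
            exact Bool.false_ne_true h
          rw [e, sStarD_empty_left]
      · by_cases ht : t = 0
        · subst ht
          by_cases h0 : ops 0 = true
          · -- `always ∨ inner` = the whole cube
            have e : A = univ := Finset.eq_univ_of_forall fun x => by
              rw [hmemA x, if_pos h0, hthr0, litVal_some_zero, Bool.true_or]
            rw [e]; exact sStarD_nonneg_of_eq_univ₁ hB hC
          · -- `always ∧ inner` = inner (axis `p` free)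
            refine hinner A fun x => ?_
            rw [hmemA x, if_neg h0, hthr0, litVal_some_zero, Bool.true_and]
        · -- a genuine literal `[t ≤ x_p]`, `t ∈ {1,2}`: the one-axis steps of `…LiteralSteps`, conjugated by `ε`
          by_cases h0 : ops 0 = true
          · set A'' : Finset (Pd (1 + d')) := univ.filter fun u : Pd (1 + d') =>
              t ≤ u (Fin.castAdd d' (0 : Fin 1)) ∨ cellOf (n := 1) u ∈ U' with hA''
            have hglue : ∀ (ξ : Pd 1) (z : Pd d'), glue ξ z ∈ A'' ↔ t ≤ ξ 0 ∨ z ∈ U' := fun ξ z => by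
              rw [hA'', Finset.mem_filter, glue_castAdd, cellOf_glue]; simp
            have hgood'' := sStarD_nonneg_literalOr_of_good t ht hU'up hgood hglue
            refine sStarD_nonneg_transfer ε hgood'' (fun x => ?_) B C hB hC
            rw [hmemA x, if_pos h0, hthr0, litVal_some, Bool.or_eq_true, decide_eq_true_iff, hA'', Finset.mem_filter, hhead x, hcell x]
            simp
          · set A'' : Finset (Pd (1 + d')) := univ.filter fun u : Pd (1 + d') =>
              t ≤ u (Fin.castAdd d' (0 : Fin 1)) ∧ cellOf (n := 1) u ∈ U' with hA''
            have hglue : ∀ (ξ : Pd 1) (z : Pd d'), glue ξ z ∈ A'' ↔ t ≤ ξ 0 ∧ z ∈ U' := fun ξ z => by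
              rw [hA'', Finset.mem_filter, glue_castAdd, cellOf_glue]; simp
            have hgood'' := sStarD_nonneg_literalAnd_of_good t ht hU'up hgood hglue
            refine sStarD_nonneg_transfer ε hgood'' (fun x => ?_) B C hB hC
            rw [hmemA x, if_neg h0, hthr0, litVal_some, Bool.and_eq_true, decide_eq_true_iff, hA'', Finset.mem_filter, hhead x, hcell x]
            simp

/-- Caterpillar patterns are up-sets (not needed above; recorded for users). [this work] -/
theorem isUpperSet_caterpillar (K : ℕ) (ops : Fin K → Bool) (thr : Fin K → Option (Fin 3)) (w : Bool)
    {d : ℕ} (σ : Fin K → Fin d) {A : Finset (Pd d)}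
    (hA : ∀ y : Pd d, y ∈ A ↔ catEval K ops (fun i => litVal (thr i) (y (σ i))) w = true) :
    IsUpperSet (A : Set (Pd d)) := by
  intro y y' hle hy
  rw [Finset.mem_coe, hA] at hy ⊢
  exact catEval_mono K ops (fun i hi => litVal_mono (hle (σ i)) hi) w hy

/-! ### Value level: Kahn's inequality for a caterpillar read-once event -/

variable {d K' : ℕ}

/-- `decide` respects logical equivalence (bookkeeping for the pulled-back literals). [this work] -/
private theorem decide_congr_iff {P Q : Prop} [Decidable P] [Decidable Q] (h : P ↔ Q) : decide P = decide Q := by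
  rcases Decidable.em Q with hq | hq
  · rw [decide_eq_true (h.2 hq), decide_eq_true hq]
  · rw [decide_eq_false (fun hp => hq (h.1 hp)), decide_eq_false hq]

/-- **The symmetrised pattern value of (caterpillar event, up-set, up-set) is nonnegative** at every three-point sample `ω` of
the grid: after sorting the three copies axis by axis, the event pulls back to a caterpillar pattern of the small cube with the same
connectives on the same axes (thresholds pulled back to `Option (Fin 3)`). [this work] -/
theorem Ssym_nonneg_caterpillar (K : ℕ) (ops : Fin K → Bool) (c : Fin K → Fin (K' + 1)) (w : Bool)
    (σ : Fin K → Fin d) (hσ : Function.Injective σ)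
    {B C : Finset (Xd d K')} (hB : IsUpperSet (B : Set (Xd d K'))) (hC : IsUpperSet (C : Set (Xd d K'))) (ω : Fin 3 → Xd d K') :
    0 ≤ Ssym (univ.filter fun x : Xd d K' => catEval K ops (fun i => decide (c i ≤ x (σ i))) w = true) B C ω := by
  classical
  set A : Finset (Xd d K') := univ.filter fun x : Xd d K' => catEval K ops (fun i => decide (c i ≤ x (σ i))) w = true with hAdef
  let π : Fin d → Equiv.Perm (Fin 3) := fun a => Tuple.sort fun cc => ω cc a
  have hsort : ∀ a, Monotone fun cc => Tmap π ω cc a := fun a => by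
    show Monotone ((fun cc => ω cc a) ∘ π a)
    exact Tuple.monotone_sort _
  rw [← S_Tmap A B C π ω, S_eq_sStarD]
  set ω' : Fin 3 → Xd d K' := Tmap π ω with hω'
  have hB' := isUpperSet_pb hsort hB
  have hC' := isUpperSet_pb hsort hC
  -- per literal: the pulled-back threshold (`none` = never satisfied)
  have ht : ∀ i : Fin K, ∃ o : Option (Fin 3), ∀ cc : Fin 3, decide (c i ≤ ω' cc (σ i)) = litVal o cc := by
    intro i
    rcases threshold_three_le (fun cc => ω' cc (σ i)) (hsort (σ i)) (c i) with h | ⟨t, h⟩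
    · exact ⟨none, fun cc => by rw [litVal_none]; exact decide_eq_false (h cc)⟩
    · exact ⟨some t, fun cc => by rw [litVal_some]; exact decide_congr_iff (h cc)⟩
  choose thr hthr using ht
  have mem_pb : ∀ q : Pd d, q ∈ pb ω' A ↔ catEval K ops (fun i => litVal (thr i) (q (σ i))) w = true := by
    intro q
    unfold pb
    rw [Finset.mem_filter, hAdef, Finset.mem_filter]
    have e : (fun i => decide (c i ≤ ω' (q (σ i)) (σ i))) = fun i => litVal (thr i) (q (σ i)) := funext fun i => hthr i _
    simp only [Finset.mem_univ, true_and, e]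
  exact sStarD_caterpillar_nonneg K ops thr w d σ hσ (pb ω' A) mem_pb _ _ hB' hC'

/-- **SAHI'S `C₃` / KAHN'S INEQUALITY WITH A CATERPILLAR READ-ONCE SLOT ON EVERY GRID, homogeneous form** (every `d, K'`):
`0 ≤ latticeE3 (⊗ g) A B C` for every nonnegative product weight, `A` a caterpillar read-once event, `B, C` up-sets. [this work] -/
theorem latticeE3_gridProd_nonneg_caterpillar (g : Fin d → Fin (K' + 1) → ℝ) (hg : ∀ a v, 0 ≤ g a v)
    (K : ℕ) (ops : Fin K → Bool) (c : Fin K → Fin (K' + 1)) (w : Bool) (σ : Fin K → Fin d) (hσ : Function.Injective σ)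
    {B C : Finset (Xd d K')} (hB : IsUpperSet (B : Set (Xd d K'))) (hC : IsUpperSet (C : Set (Xd d K'))) :
    0 ≤ latticeE3 (fun ω : Xd d K' => ∏ a, g a (ω a))
      (univ.filter fun x : Xd d K' => catEval K ops (fun i => decide (c i ≤ x (σ i))) w = true) B C := by
  have hcard : (0 : ℝ) < Fintype.card (Fin d → Equiv.Perm (Fin 3)) := by exact_mod_cast Fintype.card_pos
  have h := latticeE3_symm g (univ.filter fun x : Xd d K' => catEval K ops (fun i => decide (c i ≤ x (σ i))) w = true) B C
  have hsum : 0 ≤ ∑ ω : Fin 3 → Xd d K', (∏ cc, ∏ a, g a (ω cc a)) *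
      (Ssym (univ.filter fun x : Xd d K' => catEval K ops (fun i => decide (c i ≤ x (σ i))) w = true) B C ω : ℝ) :=
    Finset.sum_nonneg fun ω _ => mul_nonneg (Finset.prod_nonneg fun cc _ => Finset.prod_nonneg fun a _ => hg a _)
      (by exact_mod_cast Ssym_nonneg_caterpillar K ops c w σ hσ hB hC ω)
  rw [← h] at hsum
  exact (mul_nonneg_iff_of_pos_left hcard).1 hsum

/-- **KAHN'S `E₃ ≥ 0` FOR A CATERPILLAR READ-ONCE EVENT** (probability form, every grid): for every product probability weight
`⊗ g_i` on `[K'+1]^d`, every caterpillar read-once monotone formula — `K` threshold literals `[c i ≤ x (σ i)]` on distinct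
coordinates `σ i`, combined from the outside in by the connectives `ops i` (`true` = ∨, `false` = ∧) down to the seed `w` — and
all increasing events `B, C`:  `0 ≤ E₃(1_A, 1_B, 1_C)` for `A = {x : catEval K ops (i ↦ [c i ≤ x (σ i)]) w}`.
Kahn's Conjecture 5 / Sahi's `C₃` when one of the three increasing events is a caterpillar read-once function, e.g.
`x₁ ∧ (x₂ ∨ (x₃ ∧ (x₄ ∨ x₅)))`. [this work] -/
theorem sahiE_three_caterpillar_nonneg (g : Fin d → Fin (K' + 1) → ℝ) (hg0 : ∀ i v, 0 ≤ g i v) (hg1 : ∀ i, ∑ v, g i v = 1)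
    (K : ℕ) (ops : Fin K → Bool) (c : Fin K → Fin (K' + 1)) (w : Bool) (σ : Fin K → Fin d) (hσ : Function.Injective σ)
    {B C : Finset (Xd d K')} (hB : IsUpperSet (B : Set (Xd d K'))) (hC : IsUpperSet (C : Set (Xd d K'))) :
    0 ≤ sahiE (fun ω : Xd d K' => ∏ i, g i (ω i)) 3
      ![setInd (univ.filter fun x : Xd d K' => catEval K ops (fun i => decide (c i ≤ x (σ i))) w = true), setInd B, setInd C] := by
  classical
  have hsum : ∑ ω : Fin d → Fin (K' + 1), ∏ i, g i (ω i) = 1 := by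
    rw [← Fintype.prod_sum]; simp [hg1]
  rw [sahiE_three_indicator_eq_latticeE3 hsum]
  exact latticeE3_gridProd_nonneg_caterpillar g hg0 K ops c w σ hσ hB hC

end Summit.CriticalPhenomena.PercolationContinuityZ3.Theorems.SahiGridPattern
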